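import Summits.Parity.GeneralizedHardyLittlewood.Theorems.PrimeLevelFamEdgeMomentsBeyondDiagonalLayersClassBound
import HarnessLib

/-!
# Route `PrimeLevelFamEdge`, crux K_A `MomentsBeyondDiagonal` (stmt-Parity-20007), line «petersson_layers» v4:
# two bookkeeping facts for the class sums of `stub_farP`'s leading-order forms (assembly step E5b, inputs)

* `totient_div_le_classGcd`: the class factor of `…LayersClassSplit` is at most `g`: `φ(c)/φ(c/g) ≤ g` (`g ∣ c`, `c ≥ 1`;
  `φ(g·c') ≤ g·φ(c')` by induction over the prime factorisation of `g`, as in the tree's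
  `Literature.NumberTheory.Sieve.BFI.totient_mul_le`, re-proved inline to keep the BFI chain out of the imports) — together with `(c/g)^{1+ε}` from
  `…LayersClassBound(All)` this makes the class factor free: `g·(c/g)^{1+ε} ≤ c^{1+ε}` (`mul_rpow_div_le`);
* `classForm_eq_zero_of_hyperbola_empty`: a class whose hyperbolic AFE length `Y/(d₁t₁d₂t₂)` is `0` contributes nothing
  (so Pascadi's `1 ≤ N` is only ever needed for non-empty classes).
Proof only (def-free helper); K_A NOT proved; nothing about Landau–Siegel zeros.
-/

noncomputable section

open scoped Real Nat
open Complex Finset Polynomial MeasureTheory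
open Literature.NumberTheory.LFunctions

namespace Summit.Parity.GeneralizedHardyLittlewood.Theorems.MomentsBeyondDiagonal.Layers

open Summit.Parity.GeneralizedHardyLittlewood.Theorems.PrimeLevelFamEdgeIdeaDeltas.PeterssonLayers

/-- **The class factor is at most `g`**: for `c ≥ 1` and `g ∣ c`, `φ(c)/φ(c/g) ≤ g`. [folklore] -/
theorem totient_div_le_classGcd {c g : ℕ} (hc : c ≠ 0) (hg : g ∣ c) :
    ((c.totient : ℕ) : ℝ) / (((c / g).totient : ℕ) : ℝ) ≤ g := by
  have hpos := totient_div_pos hc hg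
  have hφ0 : (0 : ℝ) < (((c / g).totient : ℕ) : ℝ) := by exact_mod_cast hpos
  rw [div_le_iff₀ hφ0]
  -- `φ(d·m) ≤ d·φ(m)` (induction on `d` through primes)
  have key : ∀ d m : ℕ, Nat.totient (d * m) ≤ d * Nat.totient m := by
    intro d
    induction d using Nat.recOnMul with
    | zero => intro m; simp
    | one => intro m; simp
    | prime p hp =>
      intro m
      by_cases hpm : p ∣ m
      · rw [Nat.totient_mul_of_prime_of_dvd hp hpm]
      · rw [Nat.totient_mul_of_prime_of_not_dvd hp hpm]
        exact Nat.mul_le_mul_right _ (Nat.sub_le p 1)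
    | mul a b iha ihb =>
      intro m
      calc Nat.totient (a * b * m) = Nat.totient (a * (b * m)) := by rw [mul_assoc]
        _ ≤ a * Nat.totient (b * m) := iha (b * m)
        _ ≤ a * (b * Nat.totient m) := Nat.mul_le_mul_left _ (ihb m)
        _ = a * b * Nat.totient m := by ring
  have h := key g (c / g)
  rw [Nat.mul_div_cancel' hg] at h
  exact_mod_cast h

/-- `g · (c/g)^{1+ε} ≤ c^{1+ε}` for `g ∣ c`, `ε ≥ 0` (so the class factor times the class modulus power is at most `c^{1+ε}`).
[folklore] -/
theorem mul_rpow_div_le {c g : ℕ} (hg : g ∣ c) (hg0 : 0 < g) {ε : ℝ} (hε : 0 ≤ ε) :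
    (g : ℝ) * ((c / g : ℕ) : ℝ) ^ (1 + ε) ≤ ((c : ℕ) : ℝ) ^ (1 + ε) := by
  have hcg : ((c / g : ℕ) : ℝ) = (c : ℝ) / g := by
    rw [Nat.cast_div hg (by exact_mod_cast hg0.ne')]
  have hg1 : (1 : ℝ) ≤ g := by exact_mod_cast hg0
  have hgpos : (0 : ℝ) < g := by exact_mod_cast hg0
  have hc0 : (0 : ℝ) ≤ c := Nat.cast_nonneg c
  rw [hcg, Real.div_rpow hc0 hgpos.le]
  have hgε : (g : ℝ) ≤ (g : ℝ) ^ (1 + ε) := by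
    calc (g : ℝ) = (g : ℝ) ^ (1 : ℝ) := (Real.rpow_one _).symm
      _ ≤ (g : ℝ) ^ (1 + ε) := Real.rpow_le_rpow_of_exponent_le hg1 (by linarith)
  have hgε0 : 0 < (g : ℝ) ^ (1 + ε) := Real.rpow_pos_of_pos hgpos _
  calc (g : ℝ) * ((c : ℝ) ^ (1 + ε) / (g : ℝ) ^ (1 + ε))
      ≤ (g : ℝ) ^ (1 + ε) * ((c : ℝ) ^ (1 + ε) / (g : ℝ) ^ (1 + ε)) :=
        mul_le_mul_of_nonneg_right hgε (div_nonneg (Real.rpow_nonneg hc0 _) hgε0.le)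
    _ = (c : ℝ) ^ (1 + ε) := by field_simp

/-- **Empty hyperbola ⇒ the class contributes nothing**: if `Y/(d₁t₁·d₂t₂) = 0` (all `dᵢ, tᵢ ≥ 1`), every `B_t(h₁,h₂)` with
`h₁, h₂ ≥ 1` vanishes, hence so does the class form (any kernel `κ`, any mollifier coefficient `A`). [folklore] -/
theorem classForm_eq_zero_of_hyperbola_empty {d₁ d₂ t₁ t₂ Y : ℕ} (hD : 0 < d₁ * t₁ * (d₂ * t₂))
    (hV : Y / (d₁ * t₁ * (d₂ * t₂)) = 0) (w : ℕ → ℕ → ℂ) (c : ℕ) (G : ℕ → ℕ → ℂ) (A : ℕ → ℕ → ℂ)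
    (κ : ℕ → ℕ → ℕ → ℕ → ℂ) (S₁ S₂ : Finset ℕ) (W₁ W₂ : ℕ) :
    ∑ f₁ ∈ S₁, ∑ h₁ ∈ Icc 1 W₁, ∑ f₂ ∈ S₂, ∑ h₂ ∈ Icc 1 W₂,
      A f₁ f₂ *
        (if Nat.Coprime h₁ c ∧ Nat.Coprime h₂ c then
            (if d₁ * (t₁ * h₁) * (d₂ * (t₂ * h₂)) ≤ Y then w (d₁ * (t₁ * h₁)) (d₂ * (t₂ * h₂)) else 0) * G h₁ h₂
          else 0) * κ f₁ h₁ f₂ h₂ = 0 := by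
  refine sum_eq_zero fun f₁ _ ↦ sum_eq_zero fun h₁ hh₁ ↦ sum_eq_zero fun f₂ _ ↦ sum_eq_zero fun h₂ hh₂ ↦ ?_
  have h1 : 1 ≤ h₁ := (mem_Icc.mp hh₁).1
  have h2 : 1 ≤ h₂ := (mem_Icc.mp hh₂).1
  have hlt : Y / (d₁ * t₁ * (d₂ * t₂)) < h₁ * h₂ := by rw [hV]; exact Nat.mul_pos h1 h2
  rw [classAFE_eq_zero_of_lt hD w c G hlt, mul_zero, zero_mul]

end Summit.Parity.GeneralizedHardyLittlewood.Theorems.MomentsBeyondDiagonal.Layers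

end
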